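import Literature.NumberTheory.GaloisRepresentations.HomDualRestrictField
import Mathlib.FieldTheory.Galois.Basic
import HarnessLib

/-!
# The local layer `K'(ι L)` of a finite Galois `L ⊆ K̄` is finite Galois over `K'` (it is the splitting field
# over `K'` of a polynomial that cuts out `L` over `K`)

Topic `NumberTheory/GaloisRepresentations`; namespace `Literature.NumberTheory.GaloisRepresentations.HomDual`.
Theorems only (to be installed with `haveI`); no definition, no instance, no named fact, no `sorry`.  Sequel to
`HomDualRestrictField` (door-c6 g16: `localLayer K K' L := K'(ι L) ⊆ K̄'` along the chosen `ι : K̄ → K̄'`,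
`absClosureEmbedding`), which takes `[FiniteDimensional K' (localLayer K K' L)] [Normal K' (localLayer K K' L)]` as
HYPOTHESES of the local surjectivity `dualδ₀_units_restrict_surjective`.  Here these hypotheses are DISCHARGED, for
every extension field `K'` of `K` (in particular every completion `K_v`, archimedean or not), uniformly:

if `L/K` is finite Galois then `L` is the splitting field inside `K̄` of a separable `T ∈ K[X]`
(`IsGalois.is_separable_splitting_field`, `IntermediateField.isSplittingField_iff`), the chosen `K`-embedding `ι`
carries the roots of `T` in `K̄` onto its roots in `K̄'` (`Polynomial.Splits.image_rootSet`), hence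
**`localLayer K K' L = K'(roots of T in K̄')`** (`localLayer_eq_adjoin_rootSet`) is a splitting field of `T` over
`K'` (`isSplittingField_localLayer`), so it is **normal, finite-dimensional and Galois over `K'`**
(`normal_localLayer`, `finiteDimensional_localLayer`, `isGalois_localLayer`).  (Cassels–Fröhlich II §10: the
compositum `L_w = K_v L` is Galois over `K_v` with group the decomposition group.)

USE: the local half of hypothesis (R3) of the presentation road to Milne ADT I Lemma 4.13 / Thm. 4.10
(`middleExact_allPlaces_of_readout`, crux `stmt-BirchSwinnertonDyer-19295`, cell `bsd-schneider-ideate`) at EVERY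
place `v` with `K' = Place.Completion v` and `L = K(M)` the layer of the presentation.
HONEST FRAMING: field theory only; no case of Poitou–Tate or BSD is proved here.

## References
* J. W. S. Cassels, A. Fröhlich (eds.), *Algebraic Number Theory* (1967), Ch. II §10 (`L_w = K_v L` is normal over
  `K_v`). [CasselsFrohlichANT1967]
* J. S. Milne, *Arithmetic Duality Theorems* (2nd ed. 2006), I Lemma 4.13 (proof). [MilneADT2006]
-/

noncomputable section

namespace Literature.NumberTheory.GaloisRepresentations

namespace HomDual

open Polynomial Field IntermediateField

variable (K : Type) [Field K] (K' : Type) [Field K'] [Algebra K K']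
variable (L : IntermediateField K (AlgebraicClosure K))

/-- The roots of `T ∈ K[X]` in `K̄'` are the roots of its image in `K'[X]`. [cite: CasselsFrohlichANT1967, Ch. II §10] -/
theorem rootSet_map_algebraMap (T : K[X]) :
    (T.map (algebraMap K K')).rootSet (AlgebraicClosure K') = T.rootSet (AlgebraicClosure K') := by
  ext a
  simp only [mem_rootSet', Polynomial.map_map, ← IsScalarTower.algebraMap_eq, aeval_map_algebraMap]

/-- **`K'(ι L) = K'(roots of T in K̄')`** when `L ⊆ K̄` is the splitting field of `T ∈ K[X]` over `K`: the chosen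
`K`-embedding `ι : K̄ → K̄'` maps the roots of `T` in `K̄` onto its roots in `K̄'`.
[cite: CasselsFrohlichANT1967, Ch. II §10] -/
theorem localLayer_eq_adjoin_rootSet {T : K[X]} (hT : T.IsSplittingField K L) :
    localLayer K K' L = IntermediateField.adjoin K' (T.rootSet (AlgebraicClosure K')) := by
  obtain ⟨-, hL⟩ := IntermediateField.isSplittingField_iff.1 hT
  have himg : absClosureEmbedding K K' '' T.rootSet (AlgebraicClosure K) = T.rootSet (AlgebraicClosure K') :=
    (IsAlgClosed.splits (T.map (algebraMap K (AlgebraicClosure K)))).image_rootSet (absClosureEmbedding K K')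
  apply le_antisymm
  · rw [localLayer, IntermediateField.adjoin_le_iff]
    rintro _ ⟨x, rfl⟩
    have hx : (x : AlgebraicClosure K) ∈ IntermediateField.adjoin K (T.rootSet (AlgebraicClosure K)) := hL ▸ x.2
    have hιx : absClosureEmbedding K K' (x : AlgebraicClosure K) ∈
        (IntermediateField.adjoin K (T.rootSet (AlgebraicClosure K))).map (absClosureEmbedding K K') :=
      ⟨x, hx, rfl⟩
    rw [IntermediateField.adjoin_map, himg] at hιx
    have hle : IntermediateField.adjoin K (T.rootSet (AlgebraicClosure K')) ≤
        (IntermediateField.adjoin K' (T.rootSet (AlgebraicClosure K'))).restrictScalars K :=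
      IntermediateField.adjoin_le_iff.2 (IntermediateField.subset_adjoin K' _)
    exact hle hιx
  · rw [IntermediateField.adjoin_le_iff, ← himg]
    rintro _ ⟨y, hy, rfl⟩
    have hyL : y ∈ L := by
      rw [hL]
      exact IntermediateField.subset_adjoin K _ hy
    exact IntermediateField.subset_adjoin K' _ ⟨⟨y, hyL⟩, rfl⟩

/-- **`K'(ι L)` is a splitting field of `T` over `K'`** when `L` is one of `T` over `K`.
[cite: CasselsFrohlichANT1967, Ch. II §10] -/
theorem isSplittingField_localLayer {T : K[X]} (hT : T.IsSplittingField K L) :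
    (T.map (algebraMap K K')).IsSplittingField K' (localLayer K K' L) := by
  rw [localLayer_eq_adjoin_rootSet K K' L hT, ← rootSet_map_algebraMap K K' T]
  exact IntermediateField.adjoin_rootSet_isSplittingField (IsAlgClosed.splits _)

variable [FiniteDimensional K L] [IsGalois K L]

/-- **`K'(ι L)/K'` is normal** for `L/K` finite Galois. [cite: CasselsFrohlichANT1967, Ch. II §10] -/
theorem normal_localLayer : Normal K' (localLayer K K' L) := by
  obtain ⟨T, -, hT⟩ := IsGalois.is_separable_splitting_field K L
  haveI := isSplittingField_localLayer K K' L hT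
  exact Normal.of_isSplittingField (T.map (algebraMap K K'))

/-- **`K'(ι L)/K'` is finite** for `L/K` finite Galois. [cite: CasselsFrohlichANT1967, Ch. II §10] -/
theorem finiteDimensional_localLayer : FiniteDimensional K' (localLayer K K' L) := by
  obtain ⟨T, -, hT⟩ := IsGalois.is_separable_splitting_field K L
  haveI := isSplittingField_localLayer K K' L hT
  exact IsSplittingField.finiteDimensional (localLayer K K' L) (T.map (algebraMap K K'))

/-- **`K'(ι L)/K'` is Galois** for `L/K` finite Galois. [cite: CasselsFrohlichANT1967, Ch. II §10] -/
theorem isGalois_localLayer : IsGalois K' (localLayer K K' L) := by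
  obtain ⟨T, hsep, hT⟩ := IsGalois.is_separable_splitting_field K L
  haveI := isSplittingField_localLayer K K' L hT
  exact IsGalois.of_separable_splitting_field (p := T.map (algebraMap K K')) hsep.map

end HomDual

end Literature.NumberTheory.GaloisRepresentations

end
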